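import Literature.Computability.AlgebraicComplexity.VNPClosedUnderCoefficients
import Literature.Computability.AlgebraicComplexity.VNPClosedUnderComposition
import Literature.Computability.AlgebraicComplexity.ArithCircuitSkeletonRename
import Literature.Computability.AlgebraicComplexity.GKSS19GridInterpolation
import Literature.Computability.AlgebraicComplexity.CommutativeExtensionSimulation
import Literature.Computability.AlgebraicComplexity.RazElusiveGeneralRouteProofs
import Mathlib.FieldTheory.Finite.Extension
import Mathlib.Data.Fintype.Lattice
import HarnessLib

/-!
# `VNP` is closed under taking coefficients over EVERY field
# (Bürgisser 2024 survey, Prop. 3.1; Valiant 1982) — the characteristic-zero hypothesis removed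
# (v1: infinite fields, whence the file name; v2: finite fields too, by extension of scalars and descent)

P. Bürgisser, *Completeness classes in algebraic complexity theory*, arXiv:2406.06217 (2024), §3.1,
Prop. 3.1 (p. 13 of the held text, lines 17–26): "If `(f_n)` is `p`-definable, then any of its
coefficient sequences is `p`-definable as well" — stated over an arbitrary field `𝔽`.  The tree's
`VNPClosedUnderCoefficients.lean` proves it in CHARACTERISTIC ZERO (`IsVNPFamily.coeff`), because
its interpolation nodes are the integers `0, 1, …, d` (distinct only in characteristic `0` or
`> d`), decoded from Boolean variables by the linear form `Σ_l 2^l e_l`; its docstring leaves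
`TODO(general form): arbitrary fields (interpolate at d+1 distinct elements …)`.

This file carries out that TODO for EVERY field `F`.  INFINITE fields (v1; any characteristic,
in particular the algebraically closed fields `\bar 𝔽_p`): the nodes are `ν(0), …, ν(2^L − 1)` for
an injection `ν : ℕ ↪ F` (`Infinite.natEmbedding`), the tensor Lagrange extraction with arbitrary
nodes is the tree's `coeff_eq_sum_smul_eval_nodes` (`GKSS19GridInterpolation.lean`, `nodalDual`),
and in the `VP` witness the node VALUE `ν(dec e_i)` is read off a multilinear table polynomial
`N_i = Σ_j ν(j) · ind_j(e_{i·})` (the same device the characteristic-zero witness uses for the dual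
Vandermonde coefficients), of size `2^L (3L+2)` and degree `L` — so the witness keeps `p`-bounded
size and degree.  FINITE fields (v2; a family's degrees outgrow the field): extend scalars to the
finite extension `E_k = FiniteField.Extension F p L_k` of degree `L_k = size(deg g_k) + 1`
(`#E_k = #F^{L_k} ≥ 2^{L_k}` nodes, injectivity needed only on `{0, …, 2^{L_k} − 1}`:
`boolSum_witness_of_injOn`), run the nodal witness over `E_k`, and apply an `F`-linear retraction
`φ_k : E_k → F` coefficientwise (`CommExtSim.lmap`): it commutes with Boolean sums and with the
coefficient map (`lmap_boolSum`, `coeff_sumAlgEquiv_map`, `lmap_map_algebraMap`) and costs a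
factor `O(L_k³)` in size by the tree's Hrubeš–Yehudayoff simulation of an `L_k`-dimensional
commutative extension (`CommExtSim.complexity_lmap_le`, `CommutativeExtensionSimulation.lean`).
The survey states Prop. 3.1 over an arbitrary field without proof; the finite-field route here
(scalar extension + simulation of the extension) is the standard one and is ours to the letter.

## Main statements

* `coeff_sumAlgEquiv_eq_sum_nodes` — `[x^m] Γ(x, y) = Σ_α (∏_i λ^{(w)}_{m_i,α_i}) · Γ(w(α), y)` for
  an injective node vector `w : Fin (d+1) → F` (`x`-degrees `≤ d`).
* `CoeffVNPNodal.witness`, `CoeffVNPNodal.boolSum_witness` — coefficient extraction as ONE Boolean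
  sum `[x^m] Γ = Σ_{e ∈ {0,1}^{n L}} W(X, e)`, `W = (∏_i T_i) · Γ(N_1(e), …, N_n(e), X)`;
  `complexity_witness_le` (`L(W) ≤ L(Γ) + n(2^L(3L+2)+1) + n 2^L(3L+2) + 1`),
  `totalDegree_witness_le` (`deg W ≤ nL + deg Γ · max(L,1)`).
* `isVNPFamily_coeff_of_isVPFamily_of_injective` (any field with an injection `ν : ℕ ↪ F`),
  `isVNPFamily_coeff_of_isVPFamily_of_finite` (finite fields; `lmap_aeval_map`, `lmap_bspec`,
  `lmap_boolSum`, `totalDegree_lmap_le`, `coeff_sumAlgEquiv_map`, `exists_retraction`),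
  **`IsVNPFamily.coeff_of_infinite`** — Prop. 3.1 over EVERY field (block `Fin (a k)`; the name
  records v1's hypothesis `Infinite F`, dropped in v2 and kept for the users of v1), and
  **`IsVNPFamily.coeff_sumAlgEquiv_of_infinite`** (arbitrary finite block `ρ_k`, every field).
  (The tree's derivative closure `IsVNPFamily.foldr_pderiv` generalises by swapping in
  `coeff_sumAlgEquiv_of_infinite` — its Taylor-shift identity and `isVNPFamily_taylorShiftAll` are
  characteristic-free — see `VNPClosedUnderIteratedDerivatives.lean` v2.)

Plumbing definitions (`CoeffVNPNodal.nodeTable/dualTable/substPoly/witness`) with bodies; no named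
facts.  Honest framing: a 1982 closure property re-proved in greater generality; nothing here bears
on `VP ≠ VNP`, which is NOT proved.

## References

* [Burgisser2024Completeness] P. Bürgisser, arXiv:2406.06217 (2024), §3.1, Prop. 3.1 (p0013 L17–L26).
* [Valiant1982] L. G. Valiant, *Reducibility by algebraic projections*, L'Enseignement Math. 28
  (1982), §3 (cited through the survey; not held).
* [Burgisser2000] P. Bürgisser, *Completeness and Reduction in Algebraic Complexity Theory*,
  Springer 2000, §2.1 (interpolation), Rem. 2.7 (substitution).
* [GuoKumarSaptharishiSolomon2019] (the tree's general-node extraction `GKSS19GridInterpolation.lean`).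
* [HrubesYehudayoff2011] P. Hrubeš, A. Yehudayoff, *Arithmetic complexity in ring extensions*,
  Theory of Computing 7 (2011), Thm 4.2 (the tree's `CommutativeExtensionSimulation.lean`).
-/

noncomputable section

open MvPolynomial

namespace Literature.Computability.AlgebraicComplexity

universe u v

/-! ## §1. Coefficient extraction of `Γ(x, y)` on a grid of arbitrary distinct nodes -/

section Extraction

variable {F : Type*} [Field F] {τ : Type*} {n d : ℕ}

/-- Specialising the `x`-block of `Γ(x, y)` at constants `c` is evaluation of
`sumAlgEquiv Γ ∈ (F[y])[x]` at `C ∘ c` (the tree's `eval_sumAlgEquiv_natCast` for arbitrary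
constants). [cite: Burgisser2000, Rem. 2.7] -/
theorem eval_sumAlgEquiv_C (Γ : MvPolynomial (Fin n ⊕ τ) F) (c : Fin n → F) :
    eval (fun i => (C (c i) : MvPolynomial τ F)) (sumAlgEquiv F (Fin n) τ Γ) =
      aeval (Sum.elim (fun i => C (c i)) X) Γ := by
  have key : (eval (fun i => (C (c i) : MvPolynomial τ F))).comp
        (sumAlgEquiv F (Fin n) τ).toRingEquiv.toRingHom =
      (aeval (Sum.elim (fun i => C (c i)) X) :
        MvPolynomial (Fin n ⊕ τ) F →ₐ[F] MvPolynomial τ F).toRingHom := by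
    refine MvPolynomial.ringHom_ext (fun r => ?_) (fun v => ?_)
    · simp only [RingHom.coe_comp, Function.comp_apply, RingEquiv.toRingHom_eq_coe,
        RingEquiv.coe_toRingHom, AlgEquiv.coe_ringEquiv,
        AlgHom.toRingHom_eq_coe, AlgHom.coe_toRingHom, aeval_C, algebraMap_eq]
      rw [sumAlgEquiv_C_inl, eval_C]
    · rcases v with i | j
      · simp only [RingHom.coe_comp, Function.comp_apply, RingEquiv.toRingHom_eq_coe,
          RingEquiv.coe_toRingHom, AlgEquiv.coe_ringEquiv,
          AlgHom.toRingHom_eq_coe, AlgHom.coe_toRingHom, aeval_X, Sum.elim_inl]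
        rw [sumAlgEquiv_X_inl, eval_X]
      · simp only [RingHom.coe_comp, Function.comp_apply, RingEquiv.toRingHom_eq_coe,
          RingEquiv.coe_toRingHom, AlgEquiv.coe_ringEquiv,
          AlgHom.toRingHom_eq_coe, AlgHom.coe_toRingHom, aeval_X, Sum.elim_inr]
        rw [sumAlgEquiv_X_inr, eval_C]
  have := RingHom.congr_fun key Γ
  simpa using this

/-- **`[x^m] Γ(x,y) = Σ_α (∏ λ^{(w)}_{m_i, α_i}) · Γ(w(α), y)`** for `Γ` with `x`-degrees `≤ d` and
an injective node vector `w : Fin (d+1) → F` (the tree's `coeff_sumAlgEquiv_eq_sum` for arbitrary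
nodes, from `coeff_eq_sum_smul_eval_nodes`). [cite: Burgisser2000, §2.1] -/
theorem coeff_sumAlgEquiv_eq_sum_nodes (Γ : MvPolynomial (Fin n ⊕ τ) F)
    (hd : ∀ i, degreeOf i (sumAlgEquiv F (Fin n) τ Γ) ≤ d) {w : Fin (d + 1) → F}
    (hw : Function.Injective w) (m : Fin n →₀ ℕ) :
    coeff m (sumAlgEquiv F (Fin n) τ Γ) = ∑ α : Fin n → Fin (d + 1),
      C (∏ i, nodalDual w (m i) (α i)) * aeval (Sum.elim (fun i => C (w (α i))) X) Γ := by
  rw [coeff_eq_sum_smul_eval_nodes (F := F) (sumAlgEquiv F (Fin n) τ Γ)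
    (fun s hs i => (monomial_le_degreeOf i hs).trans (hd i)) (w := fun _ => w) (fun _ => hw) m]
  refine Finset.sum_congr rfl fun α _ => ?_
  rw [smul_eq_C_mul, ← eval_sumAlgEquiv_C Γ fun i => w (α i)]
  rfl

end Extraction

/-! ## §2. The `VP` witness with binary-decoded arbitrary nodes -/

namespace CoeffVNPNodal

open CoeffVNP

variable {F : Type u} [Field F] {τ : Type v} {n L : ℕ} (ν : ℕ → F)

/-- The node table polynomial `N_i = Σ_j ν(j) · ind_j(e_{i·})`: reads the node VALUE `ν(j)` of the
binary-decoded index `j` off a multilinear table (replaces the linear form `Σ_l 2^l e_{il}` of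
the characteristic-zero witness, whose nodes are the integers themselves). [cite: Burgisser2000, §2.1 (interpolation nodes)] -/
def nodeTable (n L : ℕ) (i : Fin n) : MvPolynomial (τ ⊕ Fin (n * L)) F :=
  ∑ j : Fin (2 ^ L), C (ν j) * indPoly n L i j

/-- The dual table polynomial `T_i = Σ_j λ^{(ν)}_{m_i, j} · ind_j(e_{i·})` (dual Lagrange
coefficients of the nodes `ν(0), …, ν(2^L − 1)`). [cite: Burgisser2000, §2.1 (interpolation)] -/
def dualTable (n L : ℕ) (m : Fin n →₀ ℕ) (i : Fin n) : MvPolynomial (τ ⊕ Fin (n * L)) F :=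
  ∑ j : Fin (2 ^ L), C (nodalDual (fun j : Fin (2 ^ L - 1 + 1) => ν j) (m i)
    (Fin.cast (Nat.sub_add_cancel Nat.one_le_two_pow).symm j)) * indPoly n L i j

/-- `Γ(N_1(e), …, N_n(e), X)`. [cite: Burgisser2000, Rem. 2.7 (substitution)] -/
def substPoly (L : ℕ) (Γ : MvPolynomial (Fin n ⊕ τ) F) : MvPolynomial (τ ⊕ Fin (n * L)) F :=
  aeval (Sum.elim (fun i => nodeTable ν n L i) fun t => X (Sum.inl t)) Γ

/-- **The `VP` witness** `W = (∏_i T_i) · Γ(N(e), X)`. [cite: Burgisser2024Completeness, Prop. 3.1 (§3.1)] -/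
def witness (L : ℕ) (Γ : MvPolynomial (Fin n ⊕ τ) F) (m : Fin n →₀ ℕ) :
    MvPolynomial (τ ⊕ Fin (n * L)) F :=
  (∏ i, dualTable ν n L m i) * substPoly ν L Γ

/-! ### Values at Boolean points -/

/-- `bspec e (C a) = C a`. [folklore] -/
private theorem bspec_C' {u : ℕ} (e : Fin u → Bool) (a : F) :
    bspec (τ := τ) e (C a) = C a := by
  simp [bspec]

/-- `bspec e (X (inl t)) = X t`. [folklore] -/
private theorem bspec_X_inl' {u : ℕ} (e : Fin u → Bool) (t : τ) :
    bspec (F := F) e (X (Sum.inl t)) = X t := by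
  simp [bspec]

/-- A literal of a bit variable evaluates to the indicator of agreement. [folklore] -/
private theorem bspec_litPoly_zv' (e : Fin (n * L) → Bool) (b : Bool) (i : Fin n) (l : Fin L) :
    bspec (F := F) (τ := τ) e (litPoly b (zv n L i l)) =
      if b = e (finProdFinEquiv (i, l)) then 1 else 0 := by
  have hz : bspec (F := F) (τ := τ) e (zv n L i l) = if e (finProdFinEquiv (i, l)) then 1 else 0 := by
    simp [bspec, zv]
  cases b <;> cases h : e (finProdFinEquiv (i, l)) <;> simp [litPoly, map_sub, hz, h]

/-- `dec e i = j` iff the bits `e_{i·}` spell `j`. [folklore] -/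
private theorem dec_eq_iff' (e : Fin (n * L) → Bool) (i : Fin n) (j : Fin (2 ^ L)) :
    dec e i = j ↔ ∀ l, bitsOf j l = e (finProdFinEquiv (i, l)) := by
  rw [dec, Equiv.apply_eq_iff_eq_symm_apply, funext_iff]
  refine forall_congr' fun l => ?_
  rw [bitsOf, Equiv.symm_apply_eq]
  exact eq_comm

/-- The indicator polynomial evaluates to `[dec e i = j]`. [folklore] -/
private theorem bspec_indPoly' (e : Fin (n * L) → Bool) (i : Fin n) (j : Fin (2 ^ L)) :
    bspec (F := F) (τ := τ) e (indPoly n L i j) = if dec e i = j then 1 else 0 := by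
  classical
  simp only [indPoly, map_prod, bspec_litPoly_zv', Finset.prod_boole, Finset.mem_univ,
    true_implies, dec_eq_iff']

/-- A table polynomial evaluates to its entry at the decoded node. [folklore] -/
private theorem bspec_table (e : Fin (n * L) → Bool) (i : Fin n) (c : Fin (2 ^ L) → F) :
    bspec (F := F) (τ := τ) e (∑ j : Fin (2 ^ L), C (c j) * indPoly n L i j) = C (c (dec e i)) := by
  classical
  simp only [map_sum, map_mul, bspec_C', bspec_indPoly', mul_boole, Finset.sum_ite_eq,
    Finset.mem_univ, if_true]

/-- `N_i([e]) = ν(dec e i)`. [cite: Burgisser2000, §2.1 (interpolation nodes)] -/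
theorem bspec_nodeTable (e : Fin (n * L) → Bool) (i : Fin n) :
    bspec (F := F) (τ := τ) e (nodeTable ν n L i) = C (ν (dec e i)) :=
  bspec_table e i _

/-- `T_i([e]) = λ^{(ν)}_{m_i, dec e i}`. [cite: Burgisser2000, §2.1 (interpolation)] -/
theorem bspec_dualTable (e : Fin (n * L) → Bool) (m : Fin n →₀ ℕ) (i : Fin n) :
    bspec (F := F) (τ := τ) e (dualTable ν n L m i) =
      C (nodalDual (fun j : Fin (2 ^ L - 1 + 1) => ν j) (m i)
        (Fin.cast (Nat.sub_add_cancel Nat.one_le_two_pow).symm (dec e i))) :=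
  bspec_table e i _

/-- `Γ(N(e), X)` at a Boolean point is `Γ` at the decoded nodes. [cite: Burgisser2000, Rem. 2.7] -/
theorem bspec_substPoly (e : Fin (n * L) → Bool) (Γ : MvPolynomial (Fin n ⊕ τ) F) :
    bspec e (substPoly ν L Γ) = aeval (Sum.elim (fun i => C (ν (dec e i))) X) Γ := by
  rw [substPoly, ← AlgHom.comp_apply, comp_aeval]
  have hfun : (fun v => bspec e (Sum.elim (fun i => nodeTable (τ := τ) ν n L i)
      (fun t => X (Sum.inl t)) v)) =
      Sum.elim (fun i => C (ν (dec e i))) (X : τ → MvPolynomial τ F) := by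
    funext v
    rcases v with i | t
    · exact bspec_nodeTable ν e i
    · exact bspec_X_inl' e t
  rw [hfun]

/-- The witness at a Boolean point is the `dec e`-term of the interpolation formula.
[cite: Burgisser2024Completeness, Prop. 3.1 (§3.1)] -/
theorem bspec_witness (e : Fin (n * L) → Bool) (Γ : MvPolynomial (Fin n ⊕ τ) F)
    (m : Fin n →₀ ℕ) :
    bspec e (witness ν L Γ m) = C (∏ i, nodalDual (fun j : Fin (2 ^ L - 1 + 1) => ν j) (m i)
        (Fin.cast (Nat.sub_add_cancel Nat.one_le_two_pow).symm (dec e i))) *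
      aeval (Sum.elim (fun i => C (ν (dec e i))) X) Γ := by
  rw [witness, map_mul, map_prod, bspec_substPoly, map_prod]
  simp only [bspec_dualTable]

/-! ### Coefficient extraction as one Boolean sum -/

/-- **`[x^m] Γ = Σ_{e ∈ {0,1}^{n·L}} W(X, e)`** for injective nodes `ν` on `{0, …, 2^L − 1}` and
`Fin n`-degrees of `Γ` at most `2^L − 1`. [cite: Burgisser2024Completeness, Prop. 3.1 (§3.1)] [cite: Burgisser2000, §2.1 (interpolation)] -/
theorem boolSum_witness (hν : Function.Injective ν) (Γ : MvPolynomial (Fin n ⊕ τ) F)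
    (m : Fin n →₀ ℕ) (hd : ∀ i, degreeOf i (sumAlgEquiv F (Fin n) τ Γ) ≤ 2 ^ L - 1) :
    boolSum (witness ν L Γ m) = coeff m (sumAlgEquiv F (Fin n) τ Γ) := by
  classical
  have hpow : 2 ^ L - 1 + 1 = 2 ^ L := Nat.sub_add_cancel Nat.one_le_two_pow
  have hw : Function.Injective (fun j : Fin (2 ^ L - 1 + 1) => ν j) :=
    fun a b h => Fin.ext (hν h)
  rw [coeff_sumAlgEquiv_eq_sum_nodes Γ hd hw m, boolSum_eq_sum_bspec]
  refine Fintype.sum_equiv ((decEquiv n L).trans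
    (Equiv.arrowCongr (Equiv.refl (Fin n)) (finCongr hpow.symm))) _ _ fun e => ?_
  rw [bspec_witness]
  simp [decEquiv, Equiv.arrowCongr]

/-- The same with injectivity of the nodes required only on `{0, …, 2^L − 1}` (for finite
coefficient fields). [cite: Burgisser2024Completeness, Prop. 3.1 (§3.1)] -/
theorem boolSum_witness_of_injOn (hν : ∀ i j, i < 2 ^ L → j < 2 ^ L → ν i = ν j → i = j)
    (Γ : MvPolynomial (Fin n ⊕ τ) F) (m : Fin n →₀ ℕ)
    (hd : ∀ i, degreeOf i (sumAlgEquiv F (Fin n) τ Γ) ≤ 2 ^ L - 1) :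
    boolSum (witness ν L Γ m) = coeff m (sumAlgEquiv F (Fin n) τ Γ) := by
  classical
  have hpow : 2 ^ L - 1 + 1 = 2 ^ L := Nat.sub_add_cancel Nat.one_le_two_pow
  have hw : Function.Injective (fun j : Fin (2 ^ L - 1 + 1) => ν j) :=
    fun a b h => Fin.ext (hν a b (by have := a.is_lt; omega) (by have := b.is_lt; omega) h)
  rw [coeff_sumAlgEquiv_eq_sum_nodes Γ hd hw m, boolSum_eq_sum_bspec]
  refine Fintype.sum_equiv ((decEquiv n L).trans
    (Equiv.arrowCongr (Equiv.refl (Fin n)) (finCongr hpow.symm))) _ _ fun e => ?_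
  rw [bspec_witness]
  simp [decEquiv, Equiv.arrowCongr]

/-! ### Size and degree of the witness -/

/-- `L(ind_j(e_{i·})) ≤ 3L`. [folklore] -/
private theorem complexity_indPoly_le' (i : Fin n) (j : Fin (2 ^ L)) :
    complexity (indPoly (F := F) (τ := τ) n L i j) ≤ 3 * L := by
  unfold indPoly
  refine (complexity_finset_prod_le _ _).trans ?_
  calc ∑ l : Fin L, complexity (litPoly (bitsOf j l) (zv (F := F) (τ := τ) n L i l)) +
        (Finset.univ : Finset (Fin L)).card
      ≤ ∑ _l : Fin L, 2 + (Finset.univ : Finset (Fin L)).card := by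
        gcongr with l
        exact (complexity_litPoly_le _ _).trans (by rw [zv, complexity_X_holds])
    _ = 3 * L := by simp; ring

/-- A table polynomial has size `≤ 2^L (3L + 2)`. [folklore] -/
private theorem complexity_table_le (i : Fin n) (c : Fin (2 ^ L) → F) :
    complexity (∑ j : Fin (2 ^ L), C (c j) * indPoly (F := F) (τ := τ) n L i j) ≤
      2 ^ L * (3 * L + 2) := by
  refine (complexity_finset_sum_le _ _).trans ?_
  have h : ∀ j : Fin (2 ^ L), complexity (C (c j) * indPoly (F := F) (τ := τ) n L i j) ≤
      3 * L + 1 := fun j => by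
    rw [← smul_eq_C_mul]
    exact (complexity_smul_le_holds _ _).trans (Nat.add_le_add_right (complexity_indPoly_le' i j) 1)
  calc ∑ j : Fin (2 ^ L), complexity (C (c j) * indPoly (F := F) (τ := τ) n L i j) +
          (Finset.univ : Finset (Fin (2 ^ L))).card
      ≤ ∑ _j : Fin (2 ^ L), (3 * L + 1) + (Finset.univ : Finset (Fin (2 ^ L))).card := by
        gcongr with j; exact h j
    _ = 2 ^ L * (3 * L + 2) := by simp; ring

/-- `L(Γ(N(e), X)) ≤ L(Γ) + n · 2^L (3L+2)` (substitution, Bürgisser Rem. 2.7). [cite: Burgisser2000, Rem. 2.7] -/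
theorem complexity_substPoly_le [Fintype τ] (Γ : MvPolynomial (Fin n ⊕ τ) F) :
    complexity (substPoly (τ := τ) ν L Γ) ≤ complexity Γ + n * (2 ^ L * (3 * L + 2)) := by
  unfold substPoly
  refine (complexity_aeval_le Γ _).trans (Nat.add_le_add_left ?_ _)
  rw [Fintype.sum_sum_type]
  simp only [Sum.elim_inl, Sum.elim_inr]
  have hX : ∑ t : τ, complexity (X (Sum.inl t) : MvPolynomial (τ ⊕ Fin (n * L)) F) = 0 :=
    Finset.sum_eq_zero fun t _ => complexity_X_holds _
  rw [hX, add_zero]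
  calc ∑ i : Fin n, complexity (nodeTable (F := F) (τ := τ) ν n L i)
      ≤ ∑ _i : Fin n, 2 ^ L * (3 * L + 2) := by
        gcongr with i; exact complexity_table_le i _
    _ = n * (2 ^ L * (3 * L + 2)) := by simp

/-- **Size of the witness**: `L(W) ≤ L(Γ) + n (2^L (3L+2) + 1) + n 2^L (3L+2) + 1`.
[cite: Burgisser2024Completeness, Prop. 3.1 (§3.1)] -/
theorem complexity_witness_le [Fintype τ] (Γ : MvPolynomial (Fin n ⊕ τ) F) (m : Fin n →₀ ℕ) :
    complexity (witness ν L Γ m) ≤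
      complexity Γ + (n * (2 ^ L * (3 * L + 2) + 1) + n * (2 ^ L * (3 * L + 2)) + 1) := by
  unfold witness
  refine (complexity_mul_le_holds _ _).trans ?_
  have h1 : complexity (∏ i, dualTable (F := F) (τ := τ) ν n L m i) ≤
      n * (2 ^ L * (3 * L + 2) + 1) := by
    refine (complexity_finset_prod_le _ _).trans ?_
    calc ∑ i : Fin n, complexity (dualTable (F := F) (τ := τ) ν n L m i) +
          (Finset.univ : Finset (Fin n)).card
        ≤ ∑ _i : Fin n, 2 ^ L * (3 * L + 2) + (Finset.univ : Finset (Fin n)).card := by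
          gcongr with i; exact complexity_table_le i _
      _ = n * (2 ^ L * (3 * L + 2) + 1) := by simp; ring
  have h2 := complexity_substPoly_le (τ := τ) (L := L) ν Γ
  omega

/-- `deg ind_j ≤ L`. [folklore] -/
private theorem totalDegree_indPoly_le' (i : Fin n) (j : Fin (2 ^ L)) :
    (indPoly (F := F) (τ := τ) n L i j).totalDegree ≤ L := by
  unfold indPoly
  refine (totalDegree_finsetProd _ _).trans ?_
  calc ∑ l : Fin L, (litPoly (bitsOf j l) (zv (F := F) (τ := τ) n L i l)).totalDegree
      ≤ ∑ _l : Fin L, 1 := by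
        gcongr with l
        exact (totalDegree_litPoly_le _ _).trans (mvPolynomial_totalDegree_X_le_one _)
    _ = L := by simp

/-- A table polynomial has degree `≤ L`. [folklore] -/
private theorem totalDegree_table_le (i : Fin n) (c : Fin (2 ^ L) → F) :
    (∑ j : Fin (2 ^ L), C (c j) * indPoly (F := F) (τ := τ) n L i j).totalDegree ≤ L := by
  refine totalDegree_finsetSum_le fun j _ => (totalDegree_mul _ _).trans ?_
  rw [totalDegree_C, zero_add]
  exact totalDegree_indPoly_le' i j

/-- `deg Γ(N(e), X) ≤ deg Γ · max(L, 1)`. [folklore] -/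
private theorem totalDegree_substPoly_le (Γ : MvPolynomial (Fin n ⊕ τ) F) :
    (substPoly (τ := τ) ν L Γ).totalDegree ≤ Γ.totalDegree * max L 1 := by
  unfold substPoly
  refine totalDegree_aeval_le_mul_of_le _ _ (fun v => ?_) Γ
  rcases v with i | t
  · exact (totalDegree_table_le i _).trans (le_max_left _ _)
  · exact (mvPolynomial_totalDegree_X_le_one _).trans (le_max_right _ _)

/-- **Degree of the witness**: `deg W ≤ nL + deg Γ · max(L,1)`. [cite: Burgisser2024Completeness, Prop. 3.1 (§3.1)] -/
theorem totalDegree_witness_le (Γ : MvPolynomial (Fin n ⊕ τ) F) (m : Fin n →₀ ℕ) :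
    (witness ν L Γ m).totalDegree ≤ n * L + Γ.totalDegree * max L 1 := by
  unfold witness
  refine (totalDegree_mul _ _).trans (add_le_add ?_ (totalDegree_substPoly_le ν Γ))
  refine (totalDegree_finsetProd _ _).trans ?_
  calc ∑ i : Fin n, (dualTable (F := F) (τ := τ) ν n L m i).totalDegree ≤ ∑ _i : Fin n, L := by
        gcongr with i; exact totalDegree_table_le i _
    _ = n * L := by simp

end CoeffVNPNodal

/-! ## §3. Proposition 3.1 over infinite fields -/

section Family

open CoeffVNP CoeffVNPNodal

variable {F : Type u} [Field F]

/-- `2^{size d} ≤ 2d + 1`. [folklore] -/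
private theorem two_pow_size_le' (d : ℕ) : 2 ^ Nat.size d ≤ 2 * d + 1 := by
  rcases Nat.eq_zero_or_pos d with rfl | hd
  · simp
  · have h1 : 0 < Nat.size d := Nat.size_pos.mpr hd
    have h2 : 2 ^ (Nat.size d - 1) ≤ d := Nat.lt_size.mp (by omega)
    calc 2 ^ Nat.size d = 2 * 2 ^ (Nat.size d - 1) := by
          rw [← pow_succ']; congr 1; omega
      _ ≤ 2 * d + 1 := by omega

/-- `size d ≤ d + 1`. [folklore] -/
private theorem size_le_succ' (d : ℕ) : Nat.size d ≤ d + 1 :=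
  Nat.size_le.mpr ((Nat.lt_two_pow_self).trans (Nat.pow_lt_pow_right (by norm_num) (by omega)))

/-- The `Fin n`-degrees of `Γ` viewed in `(F[X])[Y]` are at most the total degree of `Γ`.
[folklore] -/
private theorem degreeOf_sumAlgEquiv_le' {τ : Type v} {n : ℕ} (Γ : MvPolynomial (Fin n ⊕ τ) F)
    (i : Fin n) : degreeOf i (sumAlgEquiv F (Fin n) τ Γ) ≤ Γ.totalDegree := by
  classical
  rw [degreeOf_le_iff]
  intro s hs
  obtain ⟨β, hβ⟩ := MvPolynomial.ne_zero_iff.mp (mem_support_iff.mp hs)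
  rw [coeff_coeff_sumAlgEquiv] at hβ
  refine le_trans ?_ (le_totalDegree (mem_support_iff.mpr hβ))
  rw [Finsupp.sum_sumElim]
  refine le_trans ?_ (Nat.le_add_right _ _)
  by_cases hi : i ∈ s.support
  · exact Finset.single_le_sum (f := fun j => s j) (fun j _ => Nat.zero_le _) hi
  · rw [Finsupp.notMem_support_iff.mp hi]
    exact Nat.zero_le _

/-- **The coefficient sequences of a `VP` family are in `VNP` — over every field with an
injection `ν : ℕ ↪ F`** (i.e. every infinite field; the characteristic-zero hypothesis of the
tree's `isVNPFamily_coeff_of_isVPFamily` replaced by the node injection: the interpolation nodes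
are `ν(0), …, ν(2^L − 1)`, read off a multilinear table by the witness).
[cite: Burgisser2024Completeness, Prop. 3.1 (§3.1)] [cite: Valiant1982, §3] -/
theorem isVNPFamily_coeff_of_isVPFamily_of_injective (ν : ℕ → F) (hν : Function.Injective ν)
    {a : ℕ → ℕ} {τ : ℕ → Type v} [∀ k, Fintype (τ k)] [∀ k, DecidableEq (τ k)]
    {g : ∀ k, MvPolynomial (Fin (a k) ⊕ τ k) F} (hg : IsVPFamily g) (m : ∀ k, Fin (a k) →₀ ℕ) :
    IsVNPFamily fun k => coeff (m k) (sumAlgEquiv F (Fin (a k)) (τ k) (g k)) := by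
  obtain ⟨⟨hvars, hdeg⟩, hcx⟩ := hg
  set L : ℕ → ℕ := fun k => Nat.size (g k).totalDegree with hL
  have ha : IsPBounded a := hvars.mono fun k => by simp [Fintype.card_sum]
  have hτ : IsPBounded fun k => Fintype.card (τ k) := hvars.mono fun k => by simp [Fintype.card_sum]
  have hLb : IsPBounded L := (IsPBounded.add_holds hdeg (IsPBounded.const 1)).mono fun k =>
    size_le_succ' _
  have hPb : IsPBounded fun k => 2 ^ L k :=
    (IsPBounded.add_holds (IsPBounded.mul_holds (IsPBounded.const 2) hdeg) (IsPBounded.const 1)).mono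
      fun k => two_pow_size_le' _
  have hd : ∀ k i, degreeOf i (sumAlgEquiv F (Fin (a k)) (τ k) (g k)) ≤ 2 ^ L k - 1 :=
    fun k i => (degreeOf_sumAlgEquiv_le' _ _).trans (Nat.le_sub_one_of_lt (Nat.lt_size_self _))
  refine ⟨⟨hτ, hdeg.mono fun k => totalDegree_coeff_sumAlgEquiv_le _ _⟩,
    fun k => a k * L k, fun k => CoeffVNPNodal.witness ν (L k) (g k) (m k), ⟨⟨?_, ?_⟩, ?_⟩,
    fun k => (CoeffVNPNodal.boolSum_witness ν hν (g k) (m k) (hd k)).symm⟩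
  · -- variables of the witness: `#τ_k + a_k L_k`
    exact (IsPBounded.add_holds hτ (IsPBounded.mul_holds ha hLb)).mono fun k => by
      simp [Fintype.card_sum]
  · -- degree of the witness: `a_k L_k + deg g_k · max(L_k, 1)`
    exact (IsPBounded.add_holds (IsPBounded.mul_holds ha hLb) (IsPBounded.mul_holds hdeg
      (IsPBounded.add_holds hLb (IsPBounded.const 1)))).mono fun k =>
      (CoeffVNPNodal.totalDegree_witness_le ν _ _).trans (by
        have : max (L k) 1 ≤ L k + 1 := max_le (Nat.le_succ _) (by omega)
        exact Nat.add_le_add_left (Nat.mul_le_mul_left _ this) _)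
  · -- size of the witness
    refine (IsPBounded.add_holds hcx (IsPBounded.add_holds (IsPBounded.add_holds
      (IsPBounded.mul_holds ha (IsPBounded.add_holds (IsPBounded.mul_holds hPb
        (IsPBounded.add_holds (IsPBounded.mul_holds (IsPBounded.const 3) hLb) (IsPBounded.const 2)))
        (IsPBounded.const 1)))
      (IsPBounded.mul_holds ha (IsPBounded.mul_holds hPb
        (IsPBounded.add_holds (IsPBounded.mul_holds (IsPBounded.const 3) hLb) (IsPBounded.const 2)))))
      (IsPBounded.const 1))).mono fun k => ?_
    exact CoeffVNPNodal.complexity_witness_le ν _ _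

end Family

/-! ## §3b. Finite fields: extend scalars to a finite extension with enough nodes, then descend
(Hrubeš–Yehudayoff simulation of the extension, `CommExtSim.complexity_lmap_le`) -/

section Descent

open CommExtSim

variable {F : Type*} [Field F] {E : Type*} [Field E] [Algebra F E]

/-- `lmap φ` of a monomial. [folklore] -/
private theorem lmap_monomial {σ' : Type*} (φ : E →ₗ[F] F) (M : σ' →₀ ℕ) (c : E) :
    lmap φ (monomial M c) = monomial M (φ c) := by
  classical
  ext m'
  rw [coeff_lmap, coeff_monomial, coeff_monomial]
  split_ifs
  · rfl
  · exact map_zero φ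

/-- A retraction `φ` of `F ⊆ E` applied coefficientwise undoes extension of scalars. [folklore] -/
private theorem lmap_map_algebraMap {σ' : Type*} (φ : E →ₗ[F] F) (hφ : ∀ c, φ (algebraMap F E c) = c)
    (P : MvPolynomial σ' F) : lmap φ (MvPolynomial.map (algebraMap F E) P) = P := by
  ext m'
  rw [coeff_lmap, coeff_map, hφ]

/-- `lmap φ` commutes with substitutions by `F`-polynomials. [folklore] -/
private theorem lmap_aeval_map {σ' ρ : Type*} (φ : E →ₗ[F] F) (θ : σ' → MvPolynomial ρ F)
    (W : MvPolynomial σ' E) :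
    lmap φ (aeval (fun i => MvPolynomial.map (algebraMap F E) (θ i)) W) = aeval θ (lmap φ W) := by
  classical
  induction W using MvPolynomial.induction_on' with
  | monomial M c =>
    rw [lmap_monomial, aeval_monomial, aeval_monomial, algebraMap_eq, algebraMap_eq]
    have hprod : (M.prod fun i k => (MvPolynomial.map (algebraMap F E) (θ i)) ^ k) =
        MvPolynomial.map (algebraMap F E) (M.prod fun i k => θ i ^ k) := by
      rw [Finsupp.prod, Finsupp.prod, map_prod]
      simp only [map_pow]
    rw [hprod, lmap_C_mul_map, smul_eq_C_mul]
  | add p q hp hq => rw [map_add, lmap_add, hp, hq, lmap_add, map_add]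

/-- `lmap φ` commutes with Boolean specialisation. [folklore] -/
private theorem lmap_bspec {τ' : Type*} {u : ℕ} (φ : E →ₗ[F] F) (e : Fin u → Bool)
    (W : MvPolynomial (τ' ⊕ Fin u) E) :
    lmap φ (CoeffVNP.bspec e W) = CoeffVNP.bspec e (lmap φ W) := by
  have hθ : (Sum.elim X fun j => if e j then 1 else 0 : τ' ⊕ Fin u → MvPolynomial τ' E) =
      fun v => MvPolynomial.map (algebraMap F E)
        ((Sum.elim X fun j => if e j then 1 else 0 : τ' ⊕ Fin u → MvPolynomial τ' F) v) := by
    funext v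
    rcases v with t | j
    · simp
    · by_cases h : e j <;> simp [h]
  unfold CoeffVNP.bspec
  rw [hθ, lmap_aeval_map]

/-- `lmap φ` commutes with Valiant's Boolean sum. [folklore] -/
private theorem lmap_boolSum {τ' : Type*} {u : ℕ} (φ : E →ₗ[F] F) (W : MvPolynomial (τ' ⊕ Fin u) E) :
    lmap φ (boolSum W) = boolSum (lmap φ W) := by
  rw [CoeffVNP.boolSum_eq_sum_bspec, CoeffVNP.boolSum_eq_sum_bspec, lmap_sum]
  exact Finset.sum_congr rfl fun e _ => lmap_bspec φ e W

/-- `lmap φ` does not increase the degree. [folklore] -/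
private theorem totalDegree_lmap_le {σ' : Type*} (φ : E →ₗ[F] F) (W : MvPolynomial σ' E) :
    (lmap φ W).totalDegree ≤ W.totalDegree := by
  refine Finset.sup_mono fun m' hm => ?_
  rw [mem_support_iff, coeff_lmap] at hm
  rw [mem_support_iff]
  intro h
  exact hm (by rw [h, map_zero])

/-- Extension of scalars does not increase the degree. [folklore] -/
private theorem totalDegree_map_algebraMap_le {σ' : Type*} (P : MvPolynomial σ' F) :
    (MvPolynomial.map (algebraMap F E) P).totalDegree ≤ P.totalDegree :=
  Finset.sup_mono (support_map_subset _ _)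

/-- Separating variables commutes with extension of scalars, coefficientwise. [folklore] -/
private theorem coeff_sumAlgEquiv_map {n : ℕ} {τ' : Type*} (Γ : MvPolynomial (Fin n ⊕ τ') F)
    (m : Fin n →₀ ℕ) :
    coeff m (sumAlgEquiv E (Fin n) τ' (MvPolynomial.map (algebraMap F E) Γ)) =
      MvPolynomial.map (algebraMap F E) (coeff m (sumAlgEquiv F (Fin n) τ' Γ)) := by
  ext β
  rw [coeff_coeff_sumAlgEquiv, coeff_map, coeff_map, coeff_coeff_sumAlgEquiv]

/-- A linear retraction of `F ⊆ E` from a basis: some coordinate of `1` is invertible. [folklore] -/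
private theorem exists_retraction {ι : Type*} [Fintype ι] (b : Module.Basis ι F E) :
    ∃ φ : E →ₗ[F] F, ∀ c, φ (algebraMap F E c) = c := by
  classical
  have h1 : b.repr 1 ≠ 0 := fun h => one_ne_zero (b.repr.injective (by rw [h, map_zero]))
  obtain ⟨i, hi⟩ : ∃ i, b.repr 1 i ≠ 0 := by
    by_contra h
    push Not at h
    exact h1 (Finsupp.ext h)
  refine ⟨(b.repr 1 i)⁻¹ • b.coord i, fun c => ?_⟩
  rw [LinearMap.smul_apply, Module.Basis.coord_apply, Algebra.algebraMap_eq_smul_one, map_smul,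
    Finsupp.smul_apply, smul_eq_mul, smul_eq_mul, mul_comm]
  exact mul_inv_cancel_right₀ hi c

end Descent

section FiniteFamily

open CoeffVNP CoeffVNPNodal CommExtSim

variable {F : Type u} [Field F]

/-- **The coefficient sequences of a `VP` family are in `VNP` — over every FINITE field.**
For `F` finite of characteristic `p`, extend scalars to `E_k = FiniteField.Extension F p L_k`
(degree `L_k = size(deg g_k) + 1`, so `#E_k = #F^{L_k} ≥ 2^{L_k}` distinct nodes are available),
take the nodal witness over `E_k` (`CoeffVNPNodal.boolSum_witness_of_injOn`), and apply an
`F`-linear retraction `φ_k : E_k → F` coefficientwise: Boolean sums and the coefficient commute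
with `φ_k` (`lmap_boolSum`, `coeff_sumAlgEquiv_map`, `lmap_map_algebraMap`), and
`L_F(φ_k(W)) ≤ (5L_k³ + 6L_k² + 2L_k) L_{E_k}(W) + 3L_k` by the Hrubeš–Yehudayoff simulation of
the `L_k`-dimensional extension (`CommExtSim.complexity_lmap_le`).
[cite: Burgisser2024Completeness, Prop. 3.1 (§3.1)] [cite: Valiant1982, §3] [cite: HrubesYehudayoff2011, Thm 4.2] -/
theorem isVNPFamily_coeff_of_isVPFamily_of_finite (hF : Finite F) {a : ℕ → ℕ} {τ : ℕ → Type v}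
    [∀ k, Fintype (τ k)] [∀ k, DecidableEq (τ k)] {g : ∀ k, MvPolynomial (Fin (a k) ⊕ τ k) F}
    (hg : IsVPFamily g) (m : ∀ k, Fin (a k) →₀ ℕ) :
    IsVNPFamily fun k => coeff (m k) (sumAlgEquiv F (Fin (a k)) (τ k) (g k)) := by
  classical
  haveI : Finite F := hF
  obtain ⟨p, hp⟩ := CharP.exists F
  haveI : CharP F p := hp
  haveI : Fact p.Prime := ⟨CharP.char_is_prime F p⟩
  obtain ⟨⟨hvars, hdeg⟩, hcx⟩ := hg
  -- the extension degrees
  let L : ℕ → ℕ := fun k => Nat.size (g k).totalDegree + 1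
  let E : ℕ → Type := fun k => FiniteField.Extension F p (L k)
  -- nodes: an enumeration of `E k`
  have hcard : ∀ k, 2 ^ L k ≤ Nat.card (E k) := fun k => by
    rw [FiniteField.natCard_extension]
    exact Nat.pow_le_pow_left (Nat.succ_le_of_lt (Finite.one_lt_card (α := F))) _
  let ν : ∀ k, ℕ → E k := fun k j =>
    if h : j < Nat.card (E k) then (Finite.equivFin (E k)).symm ⟨j, h⟩ else 0
  have hν : ∀ k i j, i < 2 ^ L k → j < 2 ^ L k → ν k i = ν k j → i = j := by
    intro k i j hi hj h
    have hi' : i < Nat.card (E k) := lt_of_lt_of_le hi (hcard k)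
    have hj' : j < Nat.card (E k) := lt_of_lt_of_le hj (hcard k)
    simp only [ν, dif_pos hi', dif_pos hj'] at h
    exact Fin.mk.inj_iff.mp ((Finite.equivFin (E k)).symm.injective h)
  -- bases and retractions
  let b : ∀ k, Module.Basis (Fin (Module.finrank F (E k))) F (E k) := fun k => Module.finBasis F (E k)
  have hrank : ∀ k, Module.finrank F (E k) = L k := fun k => FiniteField.finrank_extension F p (L k)
  have hφ : ∀ k, ∃ φ : E k →ₗ[F] F, ∀ c, φ (algebraMap F (E k) c) = c :=
    fun k => exists_retraction (b k)
  choose φ hφ using hφ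
  -- bookkeeping bounds
  have ha : IsPBounded a := hvars.mono fun k => by simp [Fintype.card_sum]
  have hτ : IsPBounded fun k => Fintype.card (τ k) := hvars.mono fun k => by simp [Fintype.card_sum]
  have hLb : IsPBounded L := (IsPBounded.add_holds hdeg (IsPBounded.const 2)).mono fun k => by
    have := size_le_succ' (g k).totalDegree
    show Nat.size _ + 1 ≤ _
    omega
  have hPb : IsPBounded fun k => 2 ^ L k :=
    (IsPBounded.add_holds (IsPBounded.mul_holds (IsPBounded.const 4) hdeg) (IsPBounded.const 2)).mono
      fun k => by
        have := two_pow_size_le' (g k).totalDegree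
        show 2 ^ (Nat.size _ + 1) ≤ _
        rw [pow_succ]
        omega
  have hd : ∀ k i, degreeOf i (sumAlgEquiv (E k) (Fin (a k)) (τ k)
      (MvPolynomial.map (algebraMap F (E k)) (g k))) ≤ 2 ^ L k - 1 := fun k i =>
    ((degreeOf_sumAlgEquiv_le' _ _).trans (totalDegree_map_algebraMap_le _)).trans (by
      have := Nat.lt_size_self (g k).totalDegree
      have h2 : 2 ^ Nat.size (g k).totalDegree ≤ 2 ^ L k := Nat.pow_le_pow_right (by norm_num)
        (Nat.le_succ _)
      omega)
  -- the witness over `F`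
  refine ⟨⟨hτ, hdeg.mono fun k => totalDegree_coeff_sumAlgEquiv_le _ _⟩,
    fun k => a k * L k,
    fun k => lmap (φ k) (CoeffVNPNodal.witness (ν k) (L k)
      (MvPolynomial.map (algebraMap F (E k)) (g k)) (m k)), ⟨⟨?_, ?_⟩, ?_⟩, fun k => ?_⟩
  · -- variables
    exact (IsPBounded.add_holds hτ (IsPBounded.mul_holds ha hLb)).mono fun k => by
      simp [Fintype.card_sum]
  · -- degree
    refine (IsPBounded.add_holds (IsPBounded.mul_holds ha hLb) (IsPBounded.mul_holds hdeg
      (IsPBounded.add_holds hLb (IsPBounded.const 1)))).mono fun k =>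
      (totalDegree_lmap_le _ _).trans ((CoeffVNPNodal.totalDegree_witness_le _ _ _).trans ?_)
    have h1 := totalDegree_map_algebraMap_le (E := E k) (g k)
    have : max (L k) 1 ≤ L k + 1 := max_le (Nat.le_succ _) (by omega)
    exact Nat.add_le_add_left (Nat.mul_le_mul h1 this) _
  · -- size: Hrubeš–Yehudayoff simulation of `E k` over `F`
    have hW : IsPBounded fun k => complexity (CoeffVNPNodal.witness (ν k) (L k)
        (MvPolynomial.map (algebraMap F (E k)) (g k)) (m k)) := by
      refine (IsPBounded.add_holds hcx (IsPBounded.add_holds (IsPBounded.add_holds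
        (IsPBounded.mul_holds ha (IsPBounded.add_holds (IsPBounded.mul_holds hPb
          (IsPBounded.add_holds (IsPBounded.mul_holds (IsPBounded.const 3) hLb) (IsPBounded.const 2)))
          (IsPBounded.const 1)))
        (IsPBounded.mul_holds ha (IsPBounded.mul_holds hPb
          (IsPBounded.add_holds (IsPBounded.mul_holds (IsPBounded.const 3) hLb) (IsPBounded.const 2)))))
        (IsPBounded.const 1))).mono fun k => ?_
      exact (CoeffVNPNodal.complexity_witness_le _ _ _).trans
        (Nat.add_le_add_right (ArithCircuit.complexity_map_le _ _) _)
    have hr : IsPBounded fun k => Fintype.card (Fin (Module.finrank F (E k))) :=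
      hLb.mono fun k => by rw [Fintype.card_fin, hrank]
    refine (IsPBounded.add_holds (IsPBounded.mul_holds (IsPBounded.add_holds (IsPBounded.add_holds
      (IsPBounded.mul_holds (IsPBounded.const 5) (IsPBounded.mul_holds hr (IsPBounded.mul_holds hr hr)))
      (IsPBounded.mul_holds (IsPBounded.const 6) (IsPBounded.mul_holds hr hr)))
      (IsPBounded.mul_holds (IsPBounded.const 2) hr)) hW)
      (IsPBounded.mul_holds (IsPBounded.const 3) hr)).mono fun k => ?_
    refine (complexity_lmap_le (b k) (φ k) _).trans (le_of_eq ?_)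
    ring
  · -- the identity: descend the Boolean-sum identity over `E k` along `φ k`
    rw [← lmap_boolSum, CoeffVNPNodal.boolSum_witness_of_injOn (ν k) (hν k) _ _ (hd k),
      coeff_sumAlgEquiv_map, lmap_map_algebraMap (φ k) (hφ k)]

end FiniteFamily

/-! ## §4. Proposition 3.1 over every field; arbitrary blocks of monomial variables -/

section Blocks

open CoeffVNP

variable {F : Type u} [Field F]

/-- **Bürgisser 2024, Prop. 3.1 (Valiant 1982): `VNP` is closed under taking coefficients — over
EVERY field** (the tree's `IsVNPFamily.coeff` had `CharZero F`; v1 of this file had `Infinite F`,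
whence the name, kept for its users; since v2 no hypothesis on the field: infinite fields by
interpolation at an injection `ℕ ↪ F` (`isVNPFamily_coeff_of_isVPFamily_of_injective`), finite
fields by extension of scalars and Hrubeš–Yehudayoff descent
(`isVNPFamily_coeff_of_isVPFamily_of_finite`)). If `(f_k)` is `p`-definable,
`f_k ∈ F[Fin (a k) ⊕ τ k]`, and `m_k` is a monomial in the variables `Fin (a k)`, then the
coefficient sequence `[Y^{m_k}] f_k ∈ F[τ k]` is `p`-definable.
[cite: Burgisser2024Completeness, Prop. 3.1 (§3.1, p0013 L17–L26)] [cite: Valiant1982, §3] -/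
theorem IsVNPFamily.coeff_of_infinite {a : ℕ → ℕ} {τ : ℕ → Type v}
    [∀ k, Fintype (τ k)] [∀ k, DecidableEq (τ k)] {f : ∀ k, MvPolynomial (Fin (a k) ⊕ τ k) F}
    (hf : IsVNPFamily f) (m : ∀ k, Fin (a k) →₀ ℕ) :
    IsVNPFamily fun k => MvPolynomial.coeff (m k) (sumAlgEquiv F (Fin (a k)) (τ k) (f k)) := by
  obtain ⟨-, u, g, ⟨⟨gvars, gdeg⟩, gcx⟩, hfg⟩ := hf
  let g' : ∀ k, MvPolynomial (Fin (a k) ⊕ (τ k ⊕ Fin (u k))) F :=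
    fun k => rename (Equiv.sumAssoc (Fin (a k)) (τ k) (Fin (u k))) (g k)
  have hg' : IsVPFamily g' :=
    ⟨⟨gvars.mono fun k => le_of_eq (Fintype.card_congr (Equiv.sumAssoc _ _ _).symm),
      gdeg.mono fun k => totalDegree_rename_le _ _⟩,
      gcx.mono fun k => complexity_rename_le_holds' _ _⟩
  have h1 : IsVNPFamily fun k =>
      MvPolynomial.coeff (m k) (sumAlgEquiv F (Fin (a k)) (τ k ⊕ Fin (u k)) (g' k)) := by
    rcases finite_or_infinite F with hF | hI
    · exact isVNPFamily_coeff_of_isVPFamily_of_finite hF hg' m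
    · exact isVNPFamily_coeff_of_isVPFamily_of_injective (Infinite.natEmbedding F)
        (Infinite.natEmbedding F).injective hg' m
  have h2 := IsVNPFamily.boolSum h1
  have key : (fun k => MvPolynomial.coeff (m k) (sumAlgEquiv F (Fin (a k)) (τ k) (f k))) =
      fun k => _root_.Literature.Computability.AlgebraicComplexity.boolSum (MvPolynomial.coeff (m k)
        (sumAlgEquiv F (Fin (a k)) (τ k ⊕ Fin (u k)) (g' k))) := by
    funext k
    rw [hfg k]
    exact coeff_sumAlgEquiv_boolSum (g k) (m k)
  rw [key]
  exact h2

/-- **Prop. 3.1 for an arbitrary finite block of distinguished variables, over every field**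
(the tree's `IsVNPFamily.coeff_sumAlgEquiv` without its `CharZero` hypothesis; the name records
v1's `Infinite F`, dropped in v2).
[cite: Burgisser2024Completeness, Prop. 3.1 (§3.1, p0013 L17–L26)] [cite: Valiant1982, §3] -/
theorem IsVNPFamily.coeff_sumAlgEquiv_of_infinite {ρ τ : ℕ → Type v} [∀ k, Fintype (ρ k)]
    [∀ k, DecidableEq (ρ k)] [∀ k, Fintype (τ k)] [∀ k, DecidableEq (τ k)]
    {f : ∀ k, MvPolynomial (ρ k ⊕ τ k) F} (hf : IsVNPFamily f) (m : ∀ k, ρ k →₀ ℕ) :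
    IsVNPFamily fun k => MvPolynomial.coeff (m k) (sumAlgEquiv F (ρ k) (τ k) (f k)) := by
  let e : ∀ k, ρ k ≃ Fin (Fintype.card (ρ k)) := fun k => Fintype.equivFin (ρ k)
  have hf' : IsVNPFamily fun k => rename (Sum.map (e k) id) (f k) := by
    have h := IsVNPFamily.renameEquiv (fun k => (e k).sumCongr (Equiv.refl (τ k))) hf
    refine (iff_of_eq (congrArg IsVNPFamily (funext fun k => ?_))).1 h
    rw [renameEquiv_apply]
    rfl
  have h := IsVNPFamily.coeff_of_infinite (a := fun k => Fintype.card (ρ k)) (τ := τ) hf'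
    fun k => (m k).mapDomain (e k)
  refine (iff_of_eq (congrArg IsVNPFamily (funext fun k => ?_))).1 h
  have hmap : sumAlgEquiv F (Fin (Fintype.card (ρ k))) (τ k) (rename (Sum.map (e k) id) (f k)) =
      rename (e k) (sumAlgEquiv F (ρ k) (τ k) (f k)) := by
    have := sumAlgEquiv_rename_sumMap (R := F) (e k) (id : τ k → τ k) (f k)
    simpa [rename_id, MvPolynomial.map_id] using this
  rw [hmap, coeff_rename_mapDomain _ (e k).injective]

end Blocks

end Literature.Computability.AlgebraicComplexity
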